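import Summits.RiemannHypothesis.RiemannHypothesis.Theorems.SemilocalListPoly
import Summits.RiemannHypothesis.RiemannHypothesis.Theorems.SoninBandEnergyNumerics
import Summits.RiemannHypothesis.RiemannHypothesis.Theorems.SoninBandEnergyFourier
import Literature.NumberTheory.ConnesConsani2021.SemilocalTwist
import Literature.Analysis.OperatorTheory.LpDilation
import HarnessLib

/-!
# Polynomial Sonin-section vectors `η_{r,X}(x) = R(|x|)·1_{1 ≤ |x| ≤ X}` — generic in the data `(r, X)`

Cell `rh-explicit`, seat cc-s2-1 (sub-line (ii), S = {∞, 2}).  This is the GENERIC form of cc-s2-3's file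
`SoninCertEta` (which is hard-wired to one coefficient list `rL` and `X = 8`): for any coefficient list
`r : List ℚ` (the polynomial `R = LQ.ev r`) and any rational right end point `X`, the even function
`η(x) = R(|x|)` for `1 ≤ |x| ≤ X`, `0` otherwise, as a class `polyEta r X ∈ Lp ℂ 2 volume`, with exactly the
facts the multi-vector ("frame") entry point
`Theorems/SoninFrameBridge.not_semilocalSoninIneqOn_two_of_polyWitness_frame` consumes about each vector of a
Sonin section: `polyEta r X ∈ evenPart`, `polyEta r X ∈ vanishOn 1`, the RATIONAL Gram entries
`⟪η_r, η_{r'}⟫ = plainIPQ r r' X = 2∫₁^X R R'` and the RATIONAL twisted Gram entries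
`⟪θ₂ η_r, θ₂ η_{r'}⟫ = twistIPQ r r' X = (3/2)·plainIPQ r r' X − ½(twistIntQ r r' X + twistIntQ r' r X)`,
`twistIntQ r r' X = 2∫₂^X R(v) R'(v/2) dv` (from `Literature…inner_primeTwist_primeTwist`:
`⟪θ_pζ, θ_pζ'⟫ = (1 + p⁻¹)⟪ζ, ζ'⟫ − p^{−1/2}(⟨ζ|ϑ(p)ζ'⟩ + ⟨ζ|ϑ(p⁻¹)ζ'⟩)` with
`⟨η_r|ϑ(2)η_{r'}⟩ = 2^{−1/2}∫ conj η_r(v) η_{r'}(v/2) dv` and `⟨ζ|ϑ(p⁻¹)ζ'⟩ = conj ⟨ζ'|ϑ(p)ζ⟩`, the two factors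
`2^{−1/2}` multiplying to `1/2`).  Hence the kernel-checkable budgets `‖polyEta r X‖ ≤ N` and
`‖⟪θ₂ η_r, θ₂ η_{r'}⟫‖ ≤ Gb` from rational inequalities.  Definitions: `polyEtaCore`, `polyEtaFun`, `polyEta`,
`plainIPQ`, `twistIntQ`, `twistIPQ` (all elementary).  No facts, no axioms.
-/

set_option linter.dupNamespace false  -- the mandated namespace repeats `RiemannHypothesis`

noncomputable section

open MeasureTheory Complex Set
open scoped Real ComplexConjugate InnerProductSpace
open Summit.RiemannHypothesis.RiemannHypothesis.Theorems.SemilocalPolyWitness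
open Summit.RiemannHypothesis.RiemannHypothesis.BandEnergy (scaleList ev_scaleList inner_toLp_toLp norm_toLp_sq)
open Literature.NumberTheory.ConnesConsani2021

namespace Summit.RiemannHypothesis.RiemannHypothesis.SoninPoly

variable (r : List ℚ) (X : ℚ)

/-! ## The function `η_{r,X}` -/

/-- The inner profile `x ↦ R(|x|)` for `1 ≤ |x|`, `0` for `|x| < 1` (before cutting at `|x| ≤ X`). [folklore] -/
def polyEtaCore (x : ℝ) : ℂ := if 1 ≤ |x| then ((LQ.ev r |x| : ℝ) : ℂ) else 0

/-- **The Sonin-section vector** `η_{r,X}(x) = R(|x|)` for `1 ≤ |x| ≤ X`, `0` otherwise. [folklore] -/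
def polyEtaFun : ℝ → ℂ := (Icc (-(X : ℝ)) X).indicator (polyEtaCore r)

/-- `polyEtaCore` is measurable. [folklore] -/
theorem measurable_polyEtaCore : Measurable (polyEtaCore r) := by
  refine Measurable.ite (measurableSet_le measurable_const measurable_norm) ?_ measurable_const
  exact (Complex.continuous_ofReal.comp ((LQ.continuous_ev r).comp continuous_norm)).measurable

/-- `polyEtaFun` is measurable. [folklore] -/
theorem measurable_polyEtaFun : Measurable (polyEtaFun r X) :=
  (measurable_polyEtaCore r).indicator measurableSet_Icc

/-- Uniform bound `‖polyEtaCore x‖ ≤ absBound r X` on `[−X, X]` (for `0 ≤ X`). [folklore] -/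
theorem norm_polyEtaCore_le (hX : 0 ≤ X) {x : ℝ} (hx : x ∈ Icc (-(X : ℝ)) X) :
    ‖polyEtaCore r x‖ ≤ (LQ.absBound r X : ℝ) := by
  unfold polyEtaCore
  split_ifs with h
  · rw [Complex.norm_real, Real.norm_eq_abs]
    have hX' : |(|x|)| ≤ ((X : ℚ) : ℝ) := by
      rw [abs_abs]; exact abs_le.2 ⟨hx.1, hx.2⟩
    exact LQ.abs_ev_le_absBound r hX'
  · rw [norm_zero]; exact_mod_cast LQ.absBound_nonneg r hX

/-- `polyEtaFun ∈ L²(ℝ)` (for `0 ≤ X`). [folklore] -/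
theorem memLp_polyEtaFun (hX : 0 ≤ X) : MemLp (polyEtaFun r X) 2 (volume : Measure ℝ) := by
  rw [polyEtaFun, memLp_indicator_iff_restrict measurableSet_Icc]
  exact MemLp.of_bound (measurable_polyEtaCore r).aestronglyMeasurable (LQ.absBound r X : ℝ)
    ((ae_restrict_iff' measurableSet_Icc).2 (Filter.Eventually.of_forall fun x hx => norm_polyEtaCore_le r X hX hx))

/-- `η_{r,X}` is even. [folklore] -/
theorem polyEtaFun_neg (x : ℝ) : polyEtaFun r X (-x) = polyEtaFun r X x := by
  unfold polyEtaFun polyEtaCore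
  have h1 : (-x ∈ Icc (-(X : ℝ)) X) ↔ (x ∈ Icc (-(X : ℝ)) X) := by
    simp only [mem_Icc]; constructor <;> rintro ⟨h1, h2⟩ <;> constructor <;> linarith
  by_cases hx : x ∈ Icc (-(X : ℝ)) X
  · rw [indicator_of_mem (h1.2 hx), indicator_of_mem hx, abs_neg]
  · rw [indicator_of_notMem (fun h => hx (h1.1 h)), indicator_of_notMem hx]

/-- `η_{r,X}` vanishes on the open interval `(−1, 1)`. [folklore] -/
theorem polyEtaFun_eq_zero_of_abs_lt {x : ℝ} (hx : |x| < 1) : polyEtaFun r X x = 0 := by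
  unfold polyEtaFun polyEtaCore
  by_cases hX : x ∈ Icc (-(X : ℝ)) X
  · rw [indicator_of_mem hX, if_neg (not_le.2 hx)]
  · rw [indicator_of_notMem hX]

/-- `η_{r,X}` vanishes off `[−X, X]`. [folklore] -/
theorem polyEtaFun_eq_zero_of_not_mem {x : ℝ} (hx : x ∉ Icc (-(X : ℝ)) X) : polyEtaFun r X x = 0 :=
  indicator_of_notMem hx _

/-- On `1 ≤ x ≤ X`: `η(x) = R(x)`. [folklore] -/
theorem polyEtaFun_of_mem {x : ℝ} (hx : x ∈ Icc (1 : ℝ) X) : polyEtaFun r X x = ((LQ.ev r x : ℝ) : ℂ) := by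
  unfold polyEtaFun polyEtaCore
  have hX : x ∈ Icc (-(X : ℝ)) X := ⟨by linarith [hx.1, hx.2], hx.2⟩
  have hx0 : 0 ≤ x := by linarith [hx.1]
  rw [indicator_of_mem hX, if_pos (by rw [abs_of_nonneg hx0]; exact hx.1), abs_of_nonneg hx0]

/-- The pointwise value of `η_{r,X}` off the two intervals `[1, X]`, `[−X, −1]` is `0`. [folklore] -/
theorem polyEtaFun_eq_zero_of_not_mem_two {x : ℝ} (h1 : x ∉ Icc (1 : ℝ) X) (h2 : x ∉ Icc (-(X : ℝ)) (-1)) :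
    polyEtaFun r X x = 0 := by
  by_cases hX : x ∈ Icc (-(X : ℝ)) X
  · refine polyEtaFun_eq_zero_of_abs_lt r X (abs_lt.2 ⟨?_, ?_⟩)
    · by_contra h; exact h2 ⟨hX.1, by linarith⟩
    · by_contra h; exact h1 ⟨by linarith, hX.2⟩
  · exact polyEtaFun_eq_zero_of_not_mem r X hX

/-! ## The class `polyEta r X ∈ L²(ℝ)` -/

variable {X}

/-- **The class** `polyEta r X ∈ L²(ℝ)` of `η_{r,X}` (for `0 ≤ X`). [folklore] -/
def polyEta (hX : 0 ≤ X) : Lp ℂ 2 (volume : Measure ℝ) := (memLp_polyEtaFun r X hX).toLp (polyEtaFun r X)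

/-- `polyEta = polyEtaFun` a.e. [folklore] -/
theorem polyEta_coeFn (hX : 0 ≤ X) : (polyEta r hX : ℝ → ℂ) =ᵐ[volume] polyEtaFun r X :=
  (memLp_polyEtaFun r X hX).coeFn_toLp

/-- `polyEta r X ∈ evenPart`. [folklore] -/
theorem polyEta_mem_evenPart (hX : 0 ≤ X) : polyEta r hX ∈ evenPart := by
  rw [mem_evenPart_iff]
  have h := polyEta_coeFn r hX
  have h' : (fun x : ℝ => (polyEta r hX : ℝ → ℂ) (-x)) =ᵐ[volume] fun x => polyEtaFun r X (-x) :=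
    (Measure.measurePreserving_neg (volume : Measure ℝ)).quasiMeasurePreserving.ae_eq_comp h
  filter_upwards [h, h'] with x hx hx'
  rw [hx', hx, polyEtaFun_neg]

/-- `polyEta r X ∈ vanishOn 1` (it vanishes on `(−1, 1)`, and `{±1}` is null). [folklore] -/
theorem polyEta_mem_vanishOn (hX : 0 ≤ X) : polyEta r hX ∈ vanishOn 1 := by
  rw [mem_vanishOn_iff]
  have hnull : ∀ᵐ x : ℝ ∂volume, x ≠ 1 ∧ x ≠ -1 := by
    have h1 : ∀ᵐ x : ℝ ∂volume, x ≠ 1 := by simp [ae_iff]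
    have h2 : ∀ᵐ x : ℝ ∂volume, x ≠ -1 := by simp [ae_iff]
    exact h1.and h2
  filter_upwards [polyEta_coeFn r hX, hnull] with x hx hne hxI
  rw [hx]
  refine polyEtaFun_eq_zero_of_abs_lt r X (lt_of_le_of_ne (abs_le.2 hxI) ?_)
  intro h
  rcases abs_eq (zero_le_one) |>.1 h with h' | h'
  · exact hne.1 h'
  · exact hne.2 h'

/-! ## Gram entries: `⟪η_r, η_{r'}⟫ = 2∫₁^X R R'` -/

/-- `plainIPQ r r' X = 2∫₁^X R R'` as a rational. [folklore] -/
def plainIPQ (r r' : List ℚ) (X : ℚ) : ℚ :=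
  2 * (LQ.evQ (LQ.integ (LQ.mul r r')) X - LQ.evQ (LQ.integ (LQ.mul r r')) 1)

/-- `∫_u^w R R' = [∫ (r·r')]_u^w` in list form. [folklore] -/
theorem intervalIntegral_ev_mul_ev (r r' : List ℚ) (u w : ℝ) :
    ∫ v in u..w, LQ.ev r v * LQ.ev r' v
      = LQ.ev (LQ.integ (LQ.mul r r')) w - LQ.ev (LQ.integ (LQ.mul r r')) u := by
  have e : (fun v => LQ.ev r v * LQ.ev r' v) = fun v => LQ.ev (LQ.mul r r') v := by
    funext v; rw [LQ.ev_mul]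
  rw [e, LQ.integral_ev]

/-- The product `conj η_r(v) · η_{r'}(v)` as the sum of two indicator pieces (for `1 ≤ X`). [folklore] -/
theorem conj_polyEtaFun_mul_polyEtaFun (r r' : List ℚ) (hX : (1 : ℚ) ≤ X) (v : ℝ) :
    conj (polyEtaFun r X v) * polyEtaFun r' X v
      = (Icc (1 : ℝ) X).indicator (fun v => ((LQ.ev r v * LQ.ev r' v : ℝ) : ℂ)) v
        + (Icc (-(X : ℝ)) (-1)).indicator (fun v => ((LQ.ev r (-v) * LQ.ev r' (-v) : ℝ) : ℂ)) v := by
  have hX' : (1 : ℝ) ≤ (X : ℝ) := by exact_mod_cast hX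
  by_cases h1 : v ∈ Icc (1 : ℝ) X
  · have h2 : v ∉ Icc (-(X : ℝ)) (-1) := fun h => by linarith [h.2, h1.1]
    rw [indicator_of_mem h1, indicator_of_notMem h2, add_zero, polyEtaFun_of_mem r X h1,
      polyEtaFun_of_mem r' X h1, Complex.conj_ofReal]; push_cast; ring
  · by_cases h2 : v ∈ Icc (-(X : ℝ)) (-1)
    · have h1' : -v ∈ Icc (1 : ℝ) X := ⟨by linarith [h2.2], by linarith [h2.1]⟩
      rw [indicator_of_notMem h1, indicator_of_mem h2, zero_add, ← polyEtaFun_neg r X v,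
        ← polyEtaFun_neg r' X v, polyEtaFun_of_mem r X h1', polyEtaFun_of_mem r' X h1', Complex.conj_ofReal]
      push_cast; ring
    · rw [indicator_of_notMem h1, indicator_of_notMem h2, add_zero,
        polyEtaFun_eq_zero_of_not_mem_two r X h1 h2, map_zero, zero_mul]

/-- `∫ conj η_r · η_{r'} = plainIPQ r r' X` (for `1 ≤ X`). [folklore] -/
theorem integral_conj_polyEtaFun_mul (r r' : List ℚ) (hX : (1 : ℚ) ≤ X) :
    ∫ v, conj (polyEtaFun r X v) * polyEtaFun r' X v = (((plainIPQ r r' X : ℚ) : ℝ) : ℂ) := by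
  have hX' : (1 : ℝ) ≤ (X : ℝ) := by exact_mod_cast hX
  have hsplit : (fun v => conj (polyEtaFun r X v) * polyEtaFun r' X v)
      = (Icc (1 : ℝ) X).indicator (fun v => ((LQ.ev r v * LQ.ev r' v : ℝ) : ℂ))
        + (Icc (-(X : ℝ)) (-1)).indicator (fun v => ((LQ.ev r (-v) * LQ.ev r' (-v) : ℝ) : ℂ)) := by
    funext v; rw [conj_polyEtaFun_mul_polyEtaFun r r' hX v]; rfl
  have hc1 : Continuous fun v : ℝ => ((LQ.ev r v * LQ.ev r' v : ℝ) : ℂ) :=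
    Complex.continuous_ofReal.comp ((LQ.continuous_ev _).mul (LQ.continuous_ev _))
  have hc2 : Continuous fun v : ℝ => ((LQ.ev r (-v) * LQ.ev r' (-v) : ℝ) : ℂ) :=
    Complex.continuous_ofReal.comp (((LQ.continuous_ev _).comp continuous_neg).mul
      ((LQ.continuous_ev _).comp continuous_neg))
  rw [hsplit, integral_add' (hc1.integrableOn_Icc.integrable_indicator measurableSet_Icc)
    (hc2.integrableOn_Icc.integrable_indicator measurableSet_Icc),
    integral_indicator measurableSet_Icc, integral_indicator measurableSet_Icc, integral_complex_ofReal,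
    integral_complex_ofReal]
  have hI1 : ∫ v in Icc (1 : ℝ) X, LQ.ev r v * LQ.ev r' v
      = LQ.ev (LQ.integ (LQ.mul r r')) X - LQ.ev (LQ.integ (LQ.mul r r')) 1 := by
    rw [integral_Icc_eq_integral_Ioc, ← intervalIntegral.integral_of_le hX', intervalIntegral_ev_mul_ev]
  have hI2 : ∫ v in Icc (-(X : ℝ)) (-1), LQ.ev r (-v) * LQ.ev r' (-v)
      = LQ.ev (LQ.integ (LQ.mul r r')) X - LQ.ev (LQ.integ (LQ.mul r r')) 1 := by
    rw [integral_Icc_eq_integral_Ioc, ← intervalIntegral.integral_of_le (by linarith : (-(X : ℝ)) ≤ -1),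
      intervalIntegral.integral_comp_neg (fun v => LQ.ev r v * LQ.ev r' v)]
    norm_num
    exact intervalIntegral_ev_mul_ev r r' 1 X
  rw [hI1, hI2, plainIPQ]
  have eX : LQ.ev (LQ.integ (LQ.mul r r')) X = ((LQ.evQ (LQ.integ (LQ.mul r r')) X : ℚ) : ℝ) := by
    rw [← LQ.ev_ratCast]
  have e1 : LQ.ev (LQ.integ (LQ.mul r r')) 1 = ((LQ.evQ (LQ.integ (LQ.mul r r')) 1 : ℚ) : ℝ) := by
    rw [← LQ.ev_ratCast]; norm_num
  rw [eX, e1]; push_cast; ring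

/-- **The Gram entries are rational**: `⟪polyEta r X, polyEta r' X⟫ = plainIPQ r r' X` (`1 ≤ X`). [folklore] -/
theorem inner_polyEta (r r' : List ℚ) (hX0 : 0 ≤ X) (hX : (1 : ℚ) ≤ X) :
    ⟪polyEta r hX0, polyEta r' hX0⟫_ℂ = (((plainIPQ r r' X : ℚ) : ℝ) : ℂ) := by
  rw [polyEta, polyEta, inner_toLp_toLp, integral_conj_polyEtaFun_mul r r' hX]

/-- **The norm is rational**: `‖polyEta r X‖² = plainIPQ r r X` (`1 ≤ X`). [folklore] -/
theorem norm_polyEta_sq (hX0 : 0 ≤ X) (hX : (1 : ℚ) ≤ X) :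
    ‖polyEta r hX0‖ ^ 2 = ((plainIPQ r r X : ℚ) : ℝ) := by
  have h := inner_polyEta r r hX0 hX
  rw [inner_self_eq_norm_sq_to_K] at h
  apply Complex.ofReal_injective
  rw [Complex.ofReal_pow]
  exact h

/-- The norm budget: `plainIPQ r r X ≤ N²`, `0 ≤ N` ⇒ `‖polyEta r X‖ ≤ N`. [folklore] -/
theorem norm_polyEta_le (hX0 : 0 ≤ X) (hX : (1 : ℚ) ≤ X) {N : ℚ} (hN0 : 0 ≤ N) (hN : plainIPQ r r X ≤ N ^ 2) :
    ‖polyEta r hX0‖ ≤ ((N : ℚ) : ℝ) := by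
  have h1 : ‖polyEta r hX0‖ ^ 2 ≤ ((N : ℚ) : ℝ) ^ 2 := by
    rw [norm_polyEta_sq r hX0 hX]; exact_mod_cast hN
  have h2 : (0 : ℝ) ≤ ((N : ℚ) : ℝ) := by exact_mod_cast hN0
  exact (pow_le_pow_iff_left₀ (norm_nonneg _) h2 two_ne_zero).mp h1

/-! ## The twisted Gram entries `⟪θ₂ η_r, θ₂ η_{r'}⟫` -/

/-- `twistIntQ r r' X = 2∫₂^X R(v) R'(v/2) dv` as a rational (`R'(v/2) = ev (scaleList r' (1/2)) v`). [folklore] -/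
def twistIntQ (r r' : List ℚ) (X : ℚ) : ℚ :=
  2 * (LQ.evQ (LQ.integ (LQ.mul r (scaleList r' (1 / 2)))) X
    - LQ.evQ (LQ.integ (LQ.mul r (scaleList r' (1 / 2)))) 2)

/-- **The twisted Gram entry as a rational**:
`twistIPQ r r' X = (3/2)·plainIPQ r r' X − ½(twistIntQ r r' X + twistIntQ r' r X)`. [folklore] -/
def twistIPQ (r r' : List ℚ) (X : ℚ) : ℚ :=
  3 / 2 * plainIPQ r r' X - 1 / 2 * (twistIntQ r r' X + twistIntQ r' r X)

/-- On `2 ≤ v ≤ X`: `η_{r'}(v/2) = R'(v/2)` (needs `2 ≤ X`... only through `hv`). [folklore] -/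
theorem polyEtaFun_half_of_mem (r' : List ℚ) {v : ℝ} (hv : v ∈ Icc (2 : ℝ) X) :
    polyEtaFun r' X (2⁻¹ * v) = ((LQ.ev (scaleList r' (1 / 2)) v : ℝ) : ℂ) := by
  have h : 2⁻¹ * v ∈ Icc (1 : ℝ) X := ⟨by linarith [hv.1], by linarith [hv.1, hv.2]⟩
  rw [polyEtaFun_of_mem r' X h, ev_scaleList]; push_cast; ring_nf

/-- The product `conj η_r(v) · η_{r'}(v/2)` vanishes unless `2 ≤ |v| ≤ X` (for `0 ≤ X`). [folklore] -/
theorem conj_polyEtaFun_mul_half_eq_zero (r r' : List ℚ) (hX0 : (0 : ℚ) ≤ X) {v : ℝ} (h1 : v ∉ Icc (2 : ℝ) X)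
    (h2 : v ∉ Icc (-(X : ℝ)) (-2)) : conj (polyEtaFun r X v) * polyEtaFun r' X (2⁻¹ * v) = 0 := by
  have hX' : (0 : ℝ) ≤ (X : ℝ) := by exact_mod_cast hX0
  by_cases hX : v ∈ Icc (-(X : ℝ)) X
  · have hlt : |2⁻¹ * v| < 1 := by
      rw [abs_mul, abs_of_pos (by norm_num : (0 : ℝ) < 2⁻¹)]
      have : |v| < 2 := by
        rw [abs_lt]; constructor
        · by_contra h; exact h2 ⟨hX.1, by linarith⟩
        · by_contra h; exact h1 ⟨by linarith, hX.2⟩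
      linarith
    rw [polyEtaFun_eq_zero_of_abs_lt r' X hlt, mul_zero]
  · rw [polyEtaFun_eq_zero_of_not_mem r X hX, map_zero, zero_mul]

/-- `∫ conj η_r(v) η_{r'}(v/2) dv = 2∫₂^X R(v)R'(v/2) dv = twistIntQ r r' X` (for `2 ≤ X`). [folklore] -/
theorem integral_conj_polyEtaFun_mul_half (r r' : List ℚ) (hX : (2 : ℚ) ≤ X) :
    ∫ v, conj (polyEtaFun r X v) * polyEtaFun r' X (2⁻¹ * v) = (((twistIntQ r r' X : ℚ) : ℝ) : ℂ) := by
  have hX' : (2 : ℝ) ≤ (X : ℝ) := by exact_mod_cast hX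
  have hX0 : (0 : ℚ) ≤ X := by linarith
  have hsplit : (fun v => conj (polyEtaFun r X v) * polyEtaFun r' X (2⁻¹ * v))
      = (Icc (2 : ℝ) X).indicator (fun v => ((LQ.ev r v * LQ.ev (scaleList r' (1 / 2)) v : ℝ) : ℂ))
        + (Icc (-(X : ℝ)) (-2)).indicator
            (fun v => ((LQ.ev r (-v) * LQ.ev (scaleList r' (1 / 2)) (-v) : ℝ) : ℂ)) := by
    funext v
    simp only [Pi.add_apply]
    by_cases h1 : v ∈ Icc (2 : ℝ) X
    · have h2 : v ∉ Icc (-(X : ℝ)) (-2) := fun h => by linarith [h.2, h1.1]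
      rw [indicator_of_mem h1, indicator_of_notMem h2, add_zero,
        polyEtaFun_of_mem r X ⟨by linarith [h1.1], h1.2⟩, polyEtaFun_half_of_mem r' h1, Complex.conj_ofReal]
      push_cast; ring
    · by_cases h2 : v ∈ Icc (-(X : ℝ)) (-2)
      · have h1' : -v ∈ Icc (2 : ℝ) X := ⟨by linarith [h2.2], by linarith [h2.1]⟩
        rw [indicator_of_notMem h1, indicator_of_mem h2, zero_add, ← polyEtaFun_neg r X v,
          ← polyEtaFun_neg r' X (2⁻¹ * v), show -(2⁻¹ * v) = 2⁻¹ * (-v) by ring,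
          polyEtaFun_of_mem r X ⟨by linarith [h1'.1], h1'.2⟩, polyEtaFun_half_of_mem r' h1', Complex.conj_ofReal]
        push_cast; ring
      · rw [indicator_of_notMem h1, indicator_of_notMem h2, add_zero,
          conj_polyEtaFun_mul_half_eq_zero r r' hX0 h1 h2]
  have hc1 : Continuous fun v : ℝ => ((LQ.ev r v * LQ.ev (scaleList r' (1 / 2)) v : ℝ) : ℂ) :=
    Complex.continuous_ofReal.comp ((LQ.continuous_ev _).mul (LQ.continuous_ev _))
  have hc2 : Continuous fun v : ℝ => ((LQ.ev r (-v) * LQ.ev (scaleList r' (1 / 2)) (-v) : ℝ) : ℂ) :=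
    Complex.continuous_ofReal.comp (((LQ.continuous_ev _).comp continuous_neg).mul
      ((LQ.continuous_ev _).comp continuous_neg))
  rw [hsplit, integral_add' (hc1.integrableOn_Icc.integrable_indicator measurableSet_Icc)
    (hc2.integrableOn_Icc.integrable_indicator measurableSet_Icc),
    integral_indicator measurableSet_Icc, integral_indicator measurableSet_Icc, integral_complex_ofReal,
    integral_complex_ofReal]
  have hI : ∀ (u w : ℝ), ∫ v in u..w, LQ.ev r v * LQ.ev (scaleList r' (1 / 2)) v
      = LQ.ev (LQ.integ (LQ.mul r (scaleList r' (1 / 2)))) w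
        - LQ.ev (LQ.integ (LQ.mul r (scaleList r' (1 / 2)))) u := by
    intro u w
    have e : (fun v => LQ.ev r v * LQ.ev (scaleList r' (1 / 2)) v)
        = fun v => LQ.ev (LQ.mul r (scaleList r' (1 / 2))) v := by
      funext v; rw [LQ.ev_mul]
    rw [e, LQ.integral_ev]
  have hI1 : ∫ v in Icc (2 : ℝ) X, LQ.ev r v * LQ.ev (scaleList r' (1 / 2)) v
      = LQ.ev (LQ.integ (LQ.mul r (scaleList r' (1 / 2)))) X
        - LQ.ev (LQ.integ (LQ.mul r (scaleList r' (1 / 2)))) 2 := by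
    rw [integral_Icc_eq_integral_Ioc, ← intervalIntegral.integral_of_le hX', hI]
  have hI2 : ∫ v in Icc (-(X : ℝ)) (-2), LQ.ev r (-v) * LQ.ev (scaleList r' (1 / 2)) (-v)
      = LQ.ev (LQ.integ (LQ.mul r (scaleList r' (1 / 2)))) X
        - LQ.ev (LQ.integ (LQ.mul r (scaleList r' (1 / 2)))) 2 := by
    rw [integral_Icc_eq_integral_Ioc, ← intervalIntegral.integral_of_le (by linarith : (-(X : ℝ)) ≤ -2),
      intervalIntegral.integral_comp_neg (fun v => LQ.ev r v * LQ.ev (scaleList r' (1 / 2)) v)]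
    norm_num
    exact hI 2 X
  rw [hI1, hI2, twistIntQ]
  have eX : LQ.ev (LQ.integ (LQ.mul r (scaleList r' (1 / 2)))) X
      = ((LQ.evQ (LQ.integ (LQ.mul r (scaleList r' (1 / 2)))) X : ℚ) : ℝ) := by rw [← LQ.ev_ratCast]
  have e2 : LQ.ev (LQ.integ (LQ.mul r (scaleList r' (1 / 2)))) 2
      = ((LQ.evQ (LQ.integ (LQ.mul r (scaleList r' (1 / 2)))) 2 : ℚ) : ℝ) := by
    rw [← LQ.ev_ratCast]; norm_num
  rw [eX, e2]; push_cast; ring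

/-- `⟨η_r | ϑ(2) η_{r'}⟩ = e^{−(log 2)/2} · twistIntQ r r' X` (for `2 ≤ X`). [folklore] -/
theorem scalingCoeff_polyEta_log_two (r r' : List ℚ) (hX0 : 0 ≤ X) (hX : (2 : ℚ) ≤ X) :
    scalingCoeff (polyEta r hX0 : ℝ → ℂ) (polyEta r' hX0 : ℝ → ℂ) (Real.log 2)
      = (Real.exp (-(Real.log 2) / 2) : ℂ) * (((twistIntQ r r' X : ℚ) : ℝ) : ℂ) := by
  unfold scalingCoeff
  have hexp : Real.exp (-Real.log 2) = 2⁻¹ := by rw [Real.exp_neg, Real.exp_log (by norm_num : (0 : ℝ) < 2)]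
  have h1 := polyEta_coeFn r hX0
  have h1' := polyEta_coeFn r' hX0
  have h2 : (fun v : ℝ => (polyEta r' hX0 : ℝ → ℂ) (2⁻¹ * v)) =ᵐ[volume] fun v => polyEtaFun r' X (2⁻¹ * v) :=
    (Literature.Analysis.OperatorTheory.quasiMeasurePreserving_smul' (V := ℝ)
      (by norm_num : (2⁻¹ : ℝ) ≠ 0)).ae_eq h1'
  rw [← integral_conj_polyEtaFun_mul_half r r' hX, ← integral_const_mul]
  refine integral_congr_ae ?_
  filter_upwards [h1, h2] with v hv hv2
  rw [hv, hexp, hv2]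
  ring

/-- **The twisted Gram entry is rational**: `⟪θ₂ η_r, θ₂ η_{r'}⟫ = twistIPQ r r' X` (for `2 ≤ X`). [folklore] -/
theorem inner_primeTwist_polyEta (r r' : List ℚ) (hX0 : 0 ≤ X) (hX : (2 : ℚ) ≤ X) :
    ⟪primeTwist 2 (polyEta r hX0), primeTwist 2 (polyEta r' hX0)⟫_ℂ = (((twistIPQ r r' X : ℚ) : ℝ) : ℂ) := by
  have hX1 : (1 : ℚ) ≤ X := by linarith
  have h := inner_primeTwist_primeTwist 2 (polyEta r hX0) (polyEta r' hX0)
  simp only [Nat.cast_ofNat] at h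
  rw [h, scalingCoeff_neg, scalingCoeff_polyEta_log_two r r' hX0 hX, scalingCoeff_polyEta_log_two r' r hX0 hX,
    inner_polyEta r r' hX0 hX1, map_mul, Complex.conj_ofReal, Complex.conj_ofReal]
  have hsq : (Real.exp (-(Real.log 2 / 2)) : ℂ) * (Real.exp (-(Real.log 2) / 2) : ℂ) = 2⁻¹ := by
    rw [← Complex.ofReal_mul, ← Real.exp_add, show -(Real.log 2 / 2) + -(Real.log 2) / 2 = -Real.log 2 by ring,
      Real.exp_neg, Real.exp_log (by norm_num : (0 : ℝ) < 2)]
    push_cast; ring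
  rw [twistIPQ]
  simp only [Rat.cast_sub, Rat.cast_mul, Rat.cast_add, Rat.cast_div, Rat.cast_ofNat, Rat.cast_one,
    Complex.ofReal_sub, Complex.ofReal_mul, Complex.ofReal_add, Complex.ofReal_div, Complex.ofReal_ofNat,
    Complex.ofReal_one]
  linear_combination (-((((twistIntQ r r' X : ℚ) : ℝ) : ℂ) + (((twistIntQ r' r X : ℚ) : ℝ) : ℂ))) * hsq

/-- The twisted-Gram budget: `|twistIPQ r r' X| ≤ Gb` ⇒ `‖⟪θ₂ η_r, θ₂ η_{r'}⟫‖ ≤ Gb` (for `2 ≤ X`). [folklore] -/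
theorem norm_inner_primeTwist_polyEta_le (r r' : List ℚ) (hX0 : 0 ≤ X) (hX : (2 : ℚ) ≤ X) {Gb : ℚ}
    (hGb : |twistIPQ r r' X| ≤ Gb) :
    ‖⟪primeTwist 2 (polyEta r hX0), primeTwist 2 (polyEta r' hX0)⟫_ℂ‖ ≤ ((Gb : ℚ) : ℝ) := by
  rw [inner_primeTwist_polyEta r r' hX0 hX, Complex.norm_real, Real.norm_eq_abs]
  exact_mod_cast hGb

/-- **The twisted norm is rational**: `‖θ₂ (polyEta r X)‖² = twistIPQ r r X` (for `2 ≤ X`). [folklore] -/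
theorem norm_sq_primeTwist_polyEta (hX0 : 0 ≤ X) (hX : (2 : ℚ) ≤ X) :
    ‖primeTwist 2 (polyEta r hX0)‖ ^ 2 = ((twistIPQ r r X : ℚ) : ℝ) := by
  have h := inner_primeTwist_polyEta r r hX0 hX
  rw [inner_self_eq_norm_sq_to_K] at h
  apply Complex.ofReal_injective
  rw [Complex.ofReal_pow]
  exact h

end Summit.RiemannHypothesis.RiemannHypothesis.SoninPoly

end
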